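import Summits.Ventures.CertifiedManyBodySolver.Theorems.M3x2EdgeSplitSymReplayBoxCanon

/-! # E4 bridge lemma B1 `permTab_spec` — PROVED scratch (pen hub-lb-sym-plan-1 g4; NOT a proposal: registry frozen O3/O4).
First bridge lemma for sym-ref-1 g1's TABLE kernel (pub `hub-lb-sym-ref-1/g1-packed/PackedCanonKernel.lean`; `encSite`, `decSite`,
`d4ab`, `permTab` below are VERBATIM from it): every entry of its eight permutation arrays on the 625 site codes of the box `[−12,12]²`
IS the tree's `d4R γ` conjugated by the code, `(permTab[k]!)[s]! = encSite (d4R (treeMap k) (decSite s))`, where the index dictionary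
`treeMap k = d4All[σ57 k]` SWAPS 5 ↔ 7 (the kernel lists `(b,a)` at index 5 and `(−b,−a)` at 7; the tree's `d4All = [r0..r3, sr0..sr3]` has
`sr1 = (−b,−a)`, `sr3 = (b,a)`); the SET of maps is the same, which is all `canonP` (lex-min over 8 images + both-signs zero test) uses.
Proof architecture (the reusable point): state the table ARRAY-FREE (`permFun`), decide the 5 000-entry identity by `decide +kernel`
(kernel-only, no `ofReduceBool`; whole file 6.6 s on the farm), and bridge array indexing to `permFun` by generic `Array.getElem_map/_range`
lemmas (`permTab_get`) — evaluating the Array form itself in the kernel does NOT work (150 s, recursion-depth failure; measured). -/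
open Summit.Ventures.CertifiedManyBodySolver.Theorems.SymReplay
open Literature.Probability.LatticeModels
namespace Summit.Ventures.CertifiedManyBodySolver.Cruxes.LowerEdge_ge_m83o100.E4B1

def encSite (x : Site 2) : ℕ := (x 0 + 12).toNat * 25 + (x 1 + 12).toNat
def decSite (s : ℕ) : Site 2 := mkSite (((s / 25 : ℕ) : ℤ) - 12) (((s % 25 : ℕ) : ℤ) - 12)
def d4ab (k a b : ℕ) : ℕ × ℕ :=
  match k with
  | 0 => (a, b)
  | 1 => (24 - b, a)
  | 2 => (24 - a, 24 - b)
  | 3 => (b, 24 - a)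
  | 4 => (a, 24 - b)
  | 5 => (b, a)
  | 6 => (24 - a, b)
  | _ => (24 - b, 24 - a)
/-- Array-free form of the kernel's table entry. -/
def permFun (k s : ℕ) : ℕ := let ab := d4ab k (s / 25) (s % 25); ab.1 * 25 + ab.2
def σ57 (k : ℕ) : ℕ := if k = 5 then 7 else if k = 7 then 5 else k
def treeMap (k : ℕ) : DihedralGroup 4 := d4All.getD (σ57 k) (.r 0)

-- micro-costs
example : permFun 5 1 = 1 * 25 + 0 := by decide +kernel
example : encSite (d4R (treeMap 5) (decSite 1)) = 25 := by decide +kernel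
example : encSite (d4R (treeMap 7) (decSite 1)) = 599 := by decide +kernel  -- sr1 = (−b,−a): (−12,−11) ↦ (11,12)

/-- B1b (the mathematical content, no Arrays): one Boolean over 8 × 625. -/
def b1b : Bool := (List.range 8).all fun k => (List.range 625).all fun s => permFun k s == encSite (d4R (treeMap k) (decSite s))
theorem b1b_true : b1b = true := by decide +kernel

def rtCheck : Bool := (List.range 625).all fun s => encSite (decSite s) == s
theorem rtCheck_true : rtCheck = true := by decide +kernel

/-- The kernel's array table, verbatim. -/
def permTab : Array (Array ℕ) :=
  (Array.range 8).map fun k => (Array.range 625).map fun s => let ab := d4ab k (s / 25) (s % 25); ab.1 * 25 + ab.2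

/-- B1a: array indexing = the array-free function (generic Array lemmas, no evaluation). -/
theorem permTab_get (k s : ℕ) (hk : k < 8) (hs : s < 625) : (permTab[k]!)[s]! = permFun k s := by
  have hk' : k < permTab.size := by simpa [permTab] using hk
  rw [getElem!_pos permTab k hk']
  have hrow : permTab[k] = (Array.range 625).map fun s => let ab := d4ab k (s / 25) (s % 25); ab.1 * 25 + ab.2 := by
    simp [permTab, Array.getElem_map, Array.getElem_range]
  rw [hrow]
  have hs' : s < ((Array.range 625).map fun s => let ab := d4ab k (s / 25) (s % 25); ab.1 * 25 + ab.2).size := by simpa using hs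
  rw [getElem!_pos _ s hs']
  simp [permFun, Array.getElem_map, Array.getElem_range]

/-- B1 assembled: the kernel's table entry IS the tree's `d4R` (index dictionary σ57) on site codes. -/
theorem permTab_spec (k s : ℕ) (hk : k < 8) (hs : s < 625) :
    (permTab[k]!)[s]! = encSite (d4R (treeMap k) (decSite s)) := by
  rw [permTab_get k s hk hs]
  have h := b1b_true
  unfold b1b at h
  rw [List.all_eq_true] at h
  have h1 := h k (List.mem_range.mpr hk)
  rw [List.all_eq_true] at h1
  have h2 := h1 s (List.mem_range.mpr hs)
  simpa using h2

end Summit.Ventures.CertifiedManyBodySolver.Cruxes.LowerEdge_ge_m83o100.E4B1
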